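import Literature.NumberTheory.EllipticCurves.BigGaloisRepSelmer
import Literature.NumberTheory.EllipticCurves.PrimaryTorsionGaloisRep
import Literature.NumberTheory.EllipticCurves.ZpExtensionUnramifiedProofs
import Literature.NumberTheory.EllipticCurves.PointDivisibilityProofs
import HarnessLib

/-!
# Local inputs for the big representation `M_f = T_pE ⊗ Λ^*(Ψ⁻¹)` at the INERTIA indices and
# `p`-divisibility of `E[p^∞]` — PROVED (no named fact)

Cell `bsd-stepL` (crux `stmt-BirchSwinnertonDyer-19270`, Road FF). The kernel glue
`Summit.….XAc.map_charIdeal_le_span_of_roadFF_unr_le` asks of the object `ρf` (file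
`PrimaryTorsionGaloisRep.lean`: `(W.baseChange K).anticyclotomicBigRep p κ`) three elementary inputs,
discharged for `bigRep κ ρ` by the kernel file `ErratumRoadFiveBigRepInvariants.lean` from
hypotheses ON `A` and `κ`; this file proves those hypotheses for `A = E[p^∞]` and the tree's
`ZpExtension`:

* `ZpExtension.apply_localMap_inr` — **`κ` is trivial on every inertia index `w ∤ p`**:
  `κ (localMap K (Sum.inr w) σ) = 1` (`ℤ_p`-extensions are unramified outside `p`: the tree's local
  statement `apply_eq_one_of_mem_absInertia` for the character `κ ∘ res_{K_w}`), the `κ`-input of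
  "`I_w` acts trivially on `T ⊗ Λ^*`" (`bigRep_restrict_invariants_eq_top`), i.e. of the glue's
  divisible-invariants hypothesis `hlocf` at the indices `Sum.inr w ∈ strictSet p 𝔭 Σ`;
* `PrimaryTorsion.exists_smul_eq_of_surjective`, `WeierstrassCurve.primaryTorsion_divisible` —
  **`E[p^∞]` is `p`-divisible** (`E(F̄)` is divisible, the tree's discharged
  `zsmul_geomPoints_surjective_holds`), in the exact shape
  `∀ a, (∃ k, p^k • a = 0) → ∃ b, p • b = a` of the kernel's `C_smul_surjective` (glue `hdivf`).

References: [Washington1997] Prop. 13.2; [Lang1990] Ch. 5 §1 Lemma (i); [SilvermanAEC2009] VIII.§2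
(`0 → E[m] → E(K̄) → E(K̄) → 0`), III.4.2(a); [GreenbergLNM1716] §2 p. 62 ("as `E(F̄)` is
divisible"); [Castella2018Erratum] §2, Lemma 2.1 (where these inputs are used).
-/

noncomputable section

open Field IsDedekindDomain NumberField
open Literature.NumberTheory.EllipticCurves Literature.NumberTheory.EllipticCurves.BigGaloisRep
open Literature.NumberTheory.GaloisRepresentations

universe u

namespace Literature.NumberTheory.EllipticCurves

/-! ### §1. `κ(I_w) = 1` for `w ∤ p` -/

namespace ZpExtension

variable {K : Type u} [Field K] [NumberField K] {p : ℕ} [Fact p.Prime]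

/-- **A `ℤ_p`-extension is unramified outside `p`, at the inertia indices of
`BigGaloisRep.localMap`:** for a finite place `w ∤ p` of `K` and `σ` in the local inertia group
`I_{K_w} = absInertia K_w`, `κ(res σ) = 1` — the tree's `apply_eq_one_of_mem_absInertia` (a
continuous character `Γ_{K_w} → ℤ_p` kills inertia when the residue characteristic is `≠ p`,
`HeightOneSpectrum.ringChar_residueField_adicCompletion_ne`) applied to `κ ∘ absGaloisRestrict K K_w`.
[cite: Washington1997, Prop. 13.2] [cite: Lang1990, Ch. 5 §1, Lemma (i)] -/
theorem apply_localMap_inr (κ : ZpExtension K p) {w : HeightOneSpectrum (𝓞 K)}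
    (hw : ((p : ℕ) : 𝓞 K) ∉ w.asIdeal) (σ : LocalGroup K (Sum.inr w)) :
    κ (localMap K (Sum.inr w) σ) = 1 := by
  have hchar := w.ringChar_residueField_adicCompletion_ne hw
  exact apply_eq_one_of_mem_absInertia hchar
    (κ.toContinuousMonoidHom.comp (absGaloisRestrict K (w.adicCompletion K)))
    (σ := inertiaIncl K w σ) σ.2

/-- Pointwise form on the strict set: for every inertia index `Sum.inr w ∈ strictSet p 𝔮 Σ`
(`w ∉ Σ`, `w ∤ p`), `κ ∘ localMap K (Sum.inr w) = 1`. [cite: Washington1997, Prop. 13.2] -/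
theorem apply_localMap_eq_one_of_inr_mem_strictSet (κ : ZpExtension K p)
    (𝔮 : HeightOneSpectrum (𝓞 K)) (S : Set (HeightOneSpectrum (𝓞 K))) {w : HeightOneSpectrum (𝓞 K)}
    (hw : (Sum.inr w : LocalIndex K) ∈ strictSet p 𝔮 S) (σ : LocalGroup K (Sum.inr w)) :
    κ (localMap K (Sum.inr w) σ) = 1 :=
  apply_localMap_inr κ ((inr_mem_strictSet_iff p 𝔮 w S).1 hw).2 σ

end ZpExtension

/-! ### §2. `E[p^∞]` is `p`-divisible -/

namespace PrimaryTorsion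

variable {A : Type u} [AddCommGroup A] {p : ℕ}

/-- If `[p] : A → A` is onto then so is `[p] : A[p^∞] → A[p^∞]` (a `p`-th root of a `p`-power
torsion element is `p`-power torsion). [cite: SilvermanAEC2009, VIII.§2 (0 → E[m] → E(K̄) → E(K̄) → 0)] -/
theorem exists_smul_eq_of_surjective (h : Function.Surjective fun a : A => p • a)
    (a : PrimaryTorsion A p) : ∃ b : PrimaryTorsion A p, p • b = a := by
  obtain ⟨b, hb⟩ := h (a : A)
  have hb' : p • b = (a : A) := hb
  obtain ⟨k, hk⟩ := a.exists_pow_smul_eq_zero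
  refine ⟨mk b (k + 1) ?_, PrimaryTorsion.ext ?_⟩
  · rw [pow_succ, mul_smul, hb']
    exact hk
  · simpa using hb'

/-- The shape consumed by the kernel's `C_smul_surjective`:
`∀ a, (∃ k, p^k • a = 0) → ∃ b, p • b = a` on `A[p^∞]`. [cite: SilvermanAEC2009, VIII.§2] -/
theorem divisible_of_surjective (h : Function.Surjective fun a : A => p • a)
    (a : PrimaryTorsion A p) (_ha : ∃ k : ℕ, p ^ k • a = 0) : ∃ b : PrimaryTorsion A p, p • b = a :=
  exists_smul_eq_of_surjective h a

end PrimaryTorsion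

end Literature.NumberTheory.EllipticCurves

namespace WeierstrassCurve

open Literature.NumberTheory.EllipticCurves

variable {F : Type u} [Field F] (W : WeierstrassCurve F) [W.IsElliptic] (p : ℕ) [Fact p.Prime]

/-- **`E[p^∞]` is `p`-divisible**: `[p] : E(F̄)[p^∞] → E(F̄)[p^∞]` is onto, because `E(F̄)` is
divisible (the tree's discharged `zsmul_geomPoints_surjective_holds`). This is the input `hA` of the
kernel's `C_smul_surjective` for `M_f = T_pE ⊗ Λ^*` (`p • : M_f → M_f` onto, glue `hdivf`).
[cite: SilvermanAEC2009, VIII.§2 (0 → E[m] → E(K̄) →[m] E(K̄) → 0) with Prop. III.4.2(a)]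
[cite: GreenbergLNM1716, §2 p. 62 ("as E(F̄) is divisible")] -/
theorem primaryTorsion_divisible (a : PrimaryTorsion (geomPoints W) p)
    (_ha : ∃ k : ℕ, p ^ k • a = 0) : ∃ b : PrimaryTorsion (geomPoints W) p, p • b = a := by
  refine PrimaryTorsion.exists_smul_eq_of_surjective (fun P => ?_) a
  obtain ⟨Q, hQ⟩ := W.exists_nsmul_eq_geomPoints W.zsmul_geomPoints_surjective_holds
    (Fact.out : p.Prime).ne_zero P
  exact ⟨Q, hQ⟩

/-- `[p]` is onto on `E[p^∞]` (surjectivity form). [cite: SilvermanAEC2009, VIII.§2] -/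
theorem smul_surjective_primaryTorsion :
    Function.Surjective fun a : PrimaryTorsion (geomPoints W) p => p • a := by
  intro a
  obtain ⟨k, hk⟩ := a.exists_pow_smul_eq_zero
  exact W.primaryTorsion_divisible p a ⟨k, PrimaryTorsion.ext (by simpa using hk)⟩

end WeierstrassCurve

end
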